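import Summits.CriticalPhenomena.SAWScalingLimit.Theorems.SAWLoopFugacityFlowIsingBoundaryRatioFrameLadderTransfer
import HarnessLib

/-!
# The RSW ladder of the chart frame (stub GEO-2 of the line `fk-anchor-transfer`)
(crux `SAWLoopFugacityFlow.IsingBoundaryRatio`, stmt-CriticalPhenomena-10650)

The heart of the line runs Kesten's multi-scale ratio-limit scheme on the abstract scale frame
`F = chartFrame D φ ε δ Λ (G.comap val) η R hη hadj` of a finite volume `Λ` agreeing locally with the mesh
graph `Ω_δ` near the marked prime end `a = D.pt 0`; its abstract bricks consume the RSW LADDER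
`F.LadderRSWb p 2 c ρ M n 13` (`p = 1 - e^{-2β_c}`): for all `i < j ≤ n`, `j ≤ i + 13`, the separator bound and
the no-crossing bound for the annulus `(ρM^i, ρM^{i+1})` and the radial bound for `(ρM^i, ρM^j)`.

`eventually_chartFrame_ladderRSW` derives the ladder from the line's two RSW statements about the MESH graph,
both hypotheses here: `RoughHalfAnnulusRSWMeshLargeOf AnnPathSepG` (separator likely under the free local
measure, radial crossing unlikely under the wired local measure, for every modulus `M ≥ M₀`) and
`HalfAnnulusRadialCrossingBoundFat` (radial crossing likely under the free local measure of the fattened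
annulus, for every modulus `> 1`). The work is quantifier bookkeeping — one constant `c` = the minimum of the
mesh constant at modulus `M` and the thirteen fat constants at moduli `M, M², …, M¹³`; one `ρ₀` good for all
scales `ρM^i`, `i ≤ n`; finitely many eventual statements in `δ` combined — followed by the transfer between
the frame vocabulary and the `annIn` / `annBody` / `annEdgeFinset` vocabulary of the companion file
`…IsingBoundaryRatioFrameLadderTransfer.lean` (`chartFrame_sepBound_of_mesh`, `chartFrame_noCrossBound_of_mesh`,
`chartFrame_radialBound_of_mesh`), available under `LocalAgreement`. [folklore]
-/

noncomputable section

open scoped Classical Topology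
open Filter Set Metric SimpleGraph
open Literature.Probability.LatticeModels Literature.Probability.RandomPlanarGeometry
open UpperHalfPlane (upperHalfPlaneSet)

namespace Summit.CriticalPhenomena.SAWScalingLimit.Theorems.IsingBoundaryRatio

/-- **(GEO-2) The RSW ladder of the chart frame** from the line's mesh-graph RSW statements
`RoughHalfAnnulusRSWMeshLargeOf AnnPathSepG` and `HalfAnnulusRadialCrossingBoundFat`: for the chordal chart `φ`
there is `M₀ > 1` such that for every modulus `M ≥ M₀` one constant `c > 0` serves, for every number of scales
`n` and localisation radius `ε`, all small base scales `ρ` and all small meshes `δ`, every finite volume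
`(G, Λ)` agreeing locally with `Ω_δ` in `B(a, ε)` and containing the mesh sites of chart radius `< 2M^n ρ`, as the
constant of the bounded-span RSW ladder `LadderRSWb p 2 c ρ M n 13` of the chart frame (whatever the modulus
`η`, ceiling `R ≥ M^n ρ + η` and adjacency witness `hadj` of the frame). [folklore] -/
theorem eventually_chartFrame_ladderRSW :
    ∀ (D : DobrushinDomain) (φ : ConformalEquiv upperHalfPlaneSet D.carrier), D.IsChordalUniformizing φ →
      RoughHalfAnnulusRSWMeshLargeOf AnnPathSepG → HalfAnnulusRadialCrossingBoundFat →
    ∃ M₀ : ℝ, 1 < M₀ ∧ ∀ (M : ℝ), M₀ ≤ M → ∃ c : ℝ, 0 < c ∧ ∀ (n : ℕ) (ε : ℝ), 0 < ε →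
      ∃ ρ₀ : ℝ, 0 < ρ₀ ∧ ∀ (ρ : ℝ), 0 < ρ → ρ < ρ₀ → ∀ᶠ δ in 𝓝[>] (0 : ℝ),
        ∀ (G : SimpleGraph (Site 2)) [G.LocallyFinite] (Λ : Finset (Site 2)),
          LocalAgreement D.carrier (D.pt 0) ε δ G Λ →
          (∀ x ∈ meshDomain D.carrier δ, ‖φ.symm (meshPoint δ x)‖ < 2 * M ^ n * ρ → x ∈ Λ) →
          ∀ (η R : ℝ) (hη : 0 < η) (hadj : ∀ e ∈ (G.comap (Subtype.val : ↥Λ → Site 2)).edgeFinset, ∀ u ∈ e, ∀ v ∈ e,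
            (u.1 ∈ meshDomain D.carrier δ ∧ meshPoint δ u.1 ∈ Metric.ball (D.pt 0) ε) →
            ‖φ.symm (meshPoint δ u.1)‖ < R →
              (v.1 ∈ meshDomain D.carrier δ ∧ meshPoint δ v.1 ∈ Metric.ball (D.pt 0) ε) ∧
                |‖φ.symm (meshPoint δ v.1)‖ - ‖φ.symm (meshPoint δ u.1)‖| < η),
            M ^ n * ρ + η ≤ R →
            (chartFrame D φ ε δ Λ (G.comap Subtype.val) η R hη hadj).LadderRSWb
              (1 - Real.exp (-2 * criticalBetaTwo)) 2 c ρ M n 13 := by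
  intro D φ hφ hmesh hfat
  obtain ⟨M₀, hM₀, hmM⟩ := hmesh D φ hφ
  refine ⟨M₀, hM₀, fun M hMM => ?_⟩
  have hM : 1 < M := hM₀.trans_le hMM
  have hM0 : 0 < M := one_pos.trans hM
  obtain ⟨cm, hcm, hmε⟩ := hmM M hMM
  -- the fat constants at the moduli `M ^ (k + 1)`, `k < 13`
  choose cf hcf hfε using fun k : ℕ => hfat D φ hφ (M ^ (k + 1)) (one_lt_pow₀ hM (Nat.succ_ne_zero k))
  have h13 : (Finset.range 13).Nonempty := ⟨0, by simp⟩
  refine ⟨min cm ((Finset.range 13).inf' h13 cf),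
    lt_min hcm ((Finset.lt_inf'_iff h13).2 fun k _ => hcf k), fun n ε hε => ?_⟩
  obtain ⟨ρm, hρm, hmρ⟩ := hmε ε hε
  choose ρf hρf hfρ using fun k : ℕ => hfε k ε hε
  have hρstar : 0 < min ρm ((Finset.range 13).inf' h13 ρf) :=
    lt_min hρm ((Finset.lt_inf'_iff h13).2 fun k _ => hρf k)
  refine ⟨min ρm ((Finset.range 13).inf' h13 ρf) / M ^ n, div_pos hρstar (pow_pos hM0 n), fun ρ hρ hρlt => ?_⟩
  -- every scale `ρ M^i`, `i ≤ n`, is admissible for all fourteen statements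
  have hsc0 : ∀ i : ℕ, 0 < ρ * M ^ i := fun i => mul_pos hρ (pow_pos hM0 i)
  have hsc : ∀ i ∈ Finset.range n, ρ * M ^ i < min ρm ((Finset.range 13).inf' h13 ρf) := by
    intro i hi
    have hi' : i ≤ n := (Finset.mem_range.1 hi).le
    have h1 : ρ * M ^ i ≤ ρ * M ^ n := mul_le_mul_of_nonneg_left (pow_le_pow_right₀ hM.le hi') hρ.le
    have h2 : ρ * M ^ n < min ρm ((Finset.range 13).inf' h13 ρf) := by
      rwa [lt_div_iff₀ (pow_pos hM0 n)] at hρlt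
    exact h1.trans_lt h2
  have E1 := (Filter.eventually_all_finset (Finset.range n)).2 fun i hi =>
    hmρ (ρ * M ^ i) (hsc0 i) ((hsc i hi).trans_le (min_le_left _ _))
  have E2 := (Filter.eventually_all_finset (Finset.range n)).2 fun i hi =>
    (Filter.eventually_all_finset (Finset.range 13)).2 fun k hk =>
      hfρ k (ρ * M ^ i) (hsc0 i) ((hsc i hi).trans_le ((min_le_right _ _).trans (Finset.inf'_le _ hk)))
  filter_upwards [E1, E2] with δ h1 h2 G _ Λ hLA hdisc η R hη hadj _hR
  have hLA0 := localAgreement_discreteDomainGraph hLA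
  have hag := comap_adj_iff_meshComap_adj_of_localAgreement hLA
  have hp : (1 - Real.exp (-2 * criticalBetaTwo)) ∈ Set.Icc (0 : ℝ) 1 :=
    fkIsingParam_mem_Icc criticalBetaTwo_pos.le
  intro i j hij hj hb
  have hi : i ∈ Finset.range n := Finset.mem_range.2 (by omega)
  obtain ⟨k, rfl⟩ : ∃ k, j = i + k + 1 := ⟨j - i - 1, by omega⟩
  have hk : k ∈ Finset.range 13 := Finset.mem_range.2 (by omega)
  obtain ⟨h1a, h1b⟩ := h1 i hi Λ hLA0
  -- the volume contains the mesh sites of chart radius `< 2 M^(k+1) (ρ M^i) ≤ 2 M^n ρ`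
  have hvol : ∀ x ∈ meshDomain D.carrier δ, ‖φ.symm (meshPoint δ x)‖ < 2 * M ^ (k + 1) * (ρ * M ^ i) →
      x ∈ Λ := by
    intro x hx hlt
    refine hdisc x hx (hlt.trans_le ?_)
    have hpow : M ^ (k + 1) * M ^ i ≤ M ^ n := by
      rw [← pow_add]; exact pow_le_pow_right₀ hM.le (by omega)
    calc 2 * M ^ (k + 1) * (ρ * M ^ i) = 2 * ρ * (M ^ (k + 1) * M ^ i) := by ring
      _ ≤ 2 * ρ * M ^ n := mul_le_mul_of_nonneg_left hpow (by positivity)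
      _ = 2 * M ^ n * ρ := by ring
  have h2' := h2 i hi k hk Λ hLA0 hvol
  refine ⟨?_, ?_, ?_⟩
  · exact chartFrame_sepBound_of_mesh hag (by ring) hp two_pos ((min_le_left _ _).trans h1a)
  · exact chartFrame_noCrossBound_of_mesh hag (by ring) hp two_pos
      (h1b.trans (sub_le_sub_left (min_le_left _ _) 1))
  · exact chartFrame_radialBound_of_mesh hag (M' := M ^ (k + 1)) (by ring)
      (((min_le_right _ _).trans (Finset.inf'_le _ hk)).trans h2')

end Summit.CriticalPhenomena.SAWScalingLimit.Theorems.IsingBoundaryRatio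

end
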